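import Mathlib
import HarnessLib

/-!
# Route `KLProgramme` — engine support, route (L2), FAT layer, WEIGHTED: order-three Leibniz closed forms with the frame's third derivative entering
# only through the DATUM `K₃·Λ² ≤ k₃` (slice scale `Λ`), so that the constants stay n-free along the flow

Cell `gate-hubbard-kl`, seat p3 (g10); program «W3α = α_w rows instance», file (α2a′): variants of `spaceLeibniz3_le` / `tangentLeibniz3_le`
(`…AlphaWtScalars`) in which the term `C₁c/Λ²·K₃(√2t)³` is bounded by `(4c/Λ)(t³/Λ³)·(√2/2)C₁(K₃Λ²)` and the datum `K₃Λ² ≤ k₃` is used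
instead of `Λ ≤ e₀` (on the flow frame `K_n`, `‖D³e_{K_n}‖Λₛ²` is n-free near the top while `‖D³e_{K_n}‖` is not — FINDING «W2-HALF»).

* `spaceLeibniz3_le_of_datum`, `tangentLeibniz3_le_of_datum`.

Pure real algebra; no definitions. [folklore]
-/

noncomputable section

namespace Summit.HubbardSuperconductivity.HubbardSuperconductivity.Theorems.TorusFourierL2

set_option linter.dupNamespace false -- summit = problem name (single-conjunct summit), D-0017

set_option maxHeartbeats 800000 in
/-- **The order-three Leibniz quantity of a space direction with trivial tangency**: if `a₁ ≤ t·ā₁/Λ`, `a₂ ≤ t²·ā₂/Λ²`, `a₃ ≤ t³·ā₃/Λ³`,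
`0 ≤ t ≤ 1`, `0 < Λ ≤ e₀`, ORDER-THREE DATUM `K₃Λ² ≤ k₃`, then
`Q₃ ≤ A₀·t³·q₃/Λ³`, `q₃ = C₃(√2K₁+12K₂)³/4 + (3/2)C₂K₂(√2K₁+12K₂)e₀ + (√2/2)C₁k₃ + 3ā₁(C₂(√2K₁+10K₂)²/4 + C₁K₂e₀/2) + (3/4)ā₂C₁(√2K₁+8K₂) + ā₃`,
`A₀ = c₀·4c/Λ`. [folklore] -/
theorem spaceLeibniz3_le_of_datum {c₀ c C₁ C₂ C₃ K₁ K₂ K₃ Λ e₀ t a₁ a₂ a₃ ab₁ ab₂ ab₃ : ℝ} (hc₀ : 0 ≤ c₀) (hc : 0 ≤ c) (hC₁ : 0 ≤ C₁) (hC₂ : 0 ≤ C₂)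
    (hC₃ : 0 ≤ C₃) (hK₁ : 0 ≤ K₁) (hK₂ : 0 ≤ K₂) {k₃ : ℝ} (hk₃ : K₃ * Λ ^ 2 ≤ k₃) (hΛ : 0 < Λ) (hΛe : Λ ≤ e₀) (ht0 : 0 ≤ t) (ht1 : t ≤ 1)
    (hab₁ : 0 ≤ ab₁) (hab₂ : 0 ≤ ab₂) (ha₁ : a₁ ≤ t * ab₁ / Λ) (ha₂ : a₂ ≤ t ^ 2 * ab₂ / Λ ^ 2) (ha₃ : a₃ ≤ t ^ 3 * ab₃ / Λ ^ 3) :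
    c₀ * (1 * (C₃ * c / Λ ^ 4 * (K₁ * (Real.sqrt 2 * t) + 6 * (K₂ * (Real.sqrt 2 * t) ^ 2)) ^ 3 +
          3 * (C₂ * c / Λ ^ 3 * (K₁ * (Real.sqrt 2 * t) + 6 * (K₂ * (Real.sqrt 2 * t) ^ 2)) * (K₂ * (Real.sqrt 2 * t) ^ 2)) +
          C₁ * c / Λ ^ 2 * (K₃ * (Real.sqrt 2 * t) ^ 3)) +
        3 * (a₁ * (C₂ * c / Λ ^ 3 * (K₁ * (Real.sqrt 2 * t) + 5 * (K₂ * (Real.sqrt 2 * t) ^ 2)) ^ 2 + C₁ * c / Λ ^ 2 * (K₂ * (Real.sqrt 2 * t) ^ 2))) +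
        3 * (a₂ * (C₁ * c / Λ ^ 2 * (K₁ * (Real.sqrt 2 * t) + 4 * (K₂ * (Real.sqrt 2 * t) ^ 2)))) + a₃ * (4 * c / Λ)) ≤
      c₀ * (4 * c / Λ) * (t ^ 3 * (C₃ * (Real.sqrt 2 * K₁ + 12 * K₂) ^ 3 / 4 + 3 / 2 * C₂ * K₂ * (Real.sqrt 2 * K₁ + 12 * K₂) * e₀ +
        Real.sqrt 2 / 2 * C₁ * k₃ + 3 * ab₁ * (C₂ * (Real.sqrt 2 * K₁ + 10 * K₂) ^ 2 / 4 + C₁ * K₂ * e₀ / 2) +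
        3 / 4 * ab₂ * C₁ * (Real.sqrt 2 * K₁ + 8 * K₂) + ab₃) / Λ ^ 3) := by
  have hs2 : Real.sqrt 2 ^ 2 = 2 := Real.sq_sqrt (by norm_num)
  have hs3 : Real.sqrt 2 ^ 3 = 2 * Real.sqrt 2 := by rw [pow_succ, hs2]
  have hs0 : 0 ≤ Real.sqrt 2 := Real.sqrt_nonneg 2
  have he₀ : 0 < e₀ := lt_of_lt_of_le hΛ hΛe
  have ht2 : t ^ 2 ≤ t := by nlinarith
  have hst : (Real.sqrt 2 * t) ^ 2 = 2 * t ^ 2 := by rw [mul_pow, hs2]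
  have hst3 : (Real.sqrt 2 * t) ^ 3 = 2 * Real.sqrt 2 * t ^ 3 := by rw [mul_pow, hs3]
  -- the inner quantities are `≤ t·(…)`
  have hX : ∀ k : ℝ, 0 ≤ k → K₁ * (Real.sqrt 2 * t) + k * (K₂ * (Real.sqrt 2 * t) ^ 2) ≤ t * (Real.sqrt 2 * K₁ + 2 * k * K₂) := by
    intro k hk
    rw [hst]
    have e : t * (Real.sqrt 2 * K₁ + 2 * k * K₂) = K₁ * (Real.sqrt 2 * t) + 2 * k * (K₂ * t) := by ring
    rw [e]
    have := mul_le_mul_of_nonneg_left ht2 (by positivity : 0 ≤ 2 * k * K₂)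
    nlinarith [this]
  have hX0 : ∀ k : ℝ, 0 ≤ k → 0 ≤ K₁ * (Real.sqrt 2 * t) + k * (K₂ * (Real.sqrt 2 * t) ^ 2) := fun k hk => by positivity
  have h6 := hX 6 (by norm_num); have h60 := hX0 6 (by norm_num)
  have h5 := hX 5 (by norm_num); have h50 := hX0 5 (by norm_num)
  have h4 := hX 4 (by norm_num); have h40 := hX0 4 (by norm_num)
  have hY : K₂ * (Real.sqrt 2 * t) ^ 2 = 2 * K₂ * t ^ 2 := by rw [hst]; ring
  have hΛ2 := pow_pos hΛ 2; have hΛ3 := pow_pos hΛ 3; have hΛ4 := pow_pos hΛ 4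
  -- term A
  have TA : C₃ * c / Λ ^ 4 * (K₁ * (Real.sqrt 2 * t) + 6 * (K₂ * (Real.sqrt 2 * t) ^ 2)) ^ 3 ≤
      (4 * c / Λ) * (t ^ 3 / Λ ^ 3) * (C₃ * (Real.sqrt 2 * K₁ + 12 * K₂) ^ 3 / 4) := by
    have h := pow_le_pow_left₀ h60 h6 3
    have e6 : (2 : ℝ) * 6 = 12 := by norm_num
    rw [e6] at h
    calc C₃ * c / Λ ^ 4 * (K₁ * (Real.sqrt 2 * t) + 6 * (K₂ * (Real.sqrt 2 * t) ^ 2)) ^ 3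
        ≤ C₃ * c / Λ ^ 4 * (t * (Real.sqrt 2 * K₁ + 12 * K₂)) ^ 3 := mul_le_mul_of_nonneg_left h (by positivity)
      _ = (4 * c / Λ) * (t ^ 3 / Λ ^ 3) * (C₃ * (Real.sqrt 2 * K₁ + 12 * K₂) ^ 3 / 4) := by field_simp
  -- term B
  have TB : 3 * (C₂ * c / Λ ^ 3 * (K₁ * (Real.sqrt 2 * t) + 6 * (K₂ * (Real.sqrt 2 * t) ^ 2)) * (K₂ * (Real.sqrt 2 * t) ^ 2)) ≤
      (4 * c / Λ) * (t ^ 3 / Λ ^ 3) * (3 / 2 * C₂ * K₂ * (Real.sqrt 2 * K₁ + 12 * K₂) * e₀) := by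
    have e6 : (2 : ℝ) * 6 = 12 := by norm_num
    rw [e6] at h6
    calc 3 * (C₂ * c / Λ ^ 3 * (K₁ * (Real.sqrt 2 * t) + 6 * (K₂ * (Real.sqrt 2 * t) ^ 2)) * (K₂ * (Real.sqrt 2 * t) ^ 2))
        ≤ 3 * (C₂ * c / Λ ^ 3 * (t * (Real.sqrt 2 * K₁ + 12 * K₂)) * (K₂ * (Real.sqrt 2 * t) ^ 2)) := by
          have := mul_le_mul_of_nonneg_left h6 (by positivity : 0 ≤ C₂ * c / Λ ^ 3)
          have := mul_le_mul_of_nonneg_right this (by positivity : 0 ≤ K₂ * (Real.sqrt 2 * t) ^ 2)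
          linarith
      _ = (4 * c / Λ) * (t ^ 3 / Λ ^ 3) * (3 / 2 * C₂ * K₂ * (Real.sqrt 2 * K₁ + 12 * K₂) * Λ) := by rw [hY]; field_simp; ring
      _ ≤ (4 * c / Λ) * (t ^ 3 / Λ ^ 3) * (3 / 2 * C₂ * K₂ * (Real.sqrt 2 * K₁ + 12 * K₂) * e₀) := by gcongr
  -- term C
  have TC : C₁ * c / Λ ^ 2 * (K₃ * (Real.sqrt 2 * t) ^ 3) ≤ (4 * c / Λ) * (t ^ 3 / Λ ^ 3) * (Real.sqrt 2 / 2 * C₁ * k₃) := by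
    rw [hst3]
    calc C₁ * c / Λ ^ 2 * (K₃ * (2 * Real.sqrt 2 * t ^ 3)) = (4 * c / Λ) * (t ^ 3 / Λ ^ 3) * (Real.sqrt 2 / 2 * C₁ * (K₃ * Λ ^ 2)) := by
          field_simp; ring
      _ ≤ (4 * c / Λ) * (t ^ 3 / Λ ^ 3) * (Real.sqrt 2 / 2 * C₁ * k₃) := by gcongr
  -- term D
  have TD : 3 * (a₁ * (C₂ * c / Λ ^ 3 * (K₁ * (Real.sqrt 2 * t) + 5 * (K₂ * (Real.sqrt 2 * t) ^ 2)) ^ 2 + C₁ * c / Λ ^ 2 * (K₂ * (Real.sqrt 2 * t) ^ 2))) ≤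
      (4 * c / Λ) * (t ^ 3 / Λ ^ 3) * (3 * ab₁ * (C₂ * (Real.sqrt 2 * K₁ + 10 * K₂) ^ 2 / 4 + C₁ * K₂ * e₀ / 2)) := by
    have e5 : (2 : ℝ) * 5 = 10 := by norm_num
    rw [e5] at h5
    have hbr0 : 0 ≤ C₂ * c / Λ ^ 3 * (K₁ * (Real.sqrt 2 * t) + 5 * (K₂ * (Real.sqrt 2 * t) ^ 2)) ^ 2 + C₁ * c / Λ ^ 2 * (K₂ * (Real.sqrt 2 * t) ^ 2) := by
      positivity
    have hbr : C₂ * c / Λ ^ 3 * (K₁ * (Real.sqrt 2 * t) + 5 * (K₂ * (Real.sqrt 2 * t) ^ 2)) ^ 2 + C₁ * c / Λ ^ 2 * (K₂ * (Real.sqrt 2 * t) ^ 2) ≤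
        t ^ 2 * (C₂ * c * (Real.sqrt 2 * K₁ + 10 * K₂) ^ 2 / Λ ^ 3 + 2 * C₁ * c * K₂ / Λ ^ 2) := by
      have hsq := pow_le_pow_left₀ h50 h5 2
      have t1 := mul_le_mul_of_nonneg_left hsq (by positivity : 0 ≤ C₂ * c / Λ ^ 3)
      have e : t ^ 2 * (C₂ * c * (Real.sqrt 2 * K₁ + 10 * K₂) ^ 2 / Λ ^ 3 + 2 * C₁ * c * K₂ / Λ ^ 2) =
          C₂ * c / Λ ^ 3 * (t * (Real.sqrt 2 * K₁ + 10 * K₂)) ^ 2 + C₁ * c / Λ ^ 2 * (K₂ * (Real.sqrt 2 * t) ^ 2) := by rw [hY]; ring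
      rw [e]; linarith
    calc 3 * (a₁ * (C₂ * c / Λ ^ 3 * (K₁ * (Real.sqrt 2 * t) + 5 * (K₂ * (Real.sqrt 2 * t) ^ 2)) ^ 2 + C₁ * c / Λ ^ 2 * (K₂ * (Real.sqrt 2 * t) ^ 2)))
        ≤ 3 * ((t * ab₁ / Λ) * (t ^ 2 * (C₂ * c * (Real.sqrt 2 * K₁ + 10 * K₂) ^ 2 / Λ ^ 3 + 2 * C₁ * c * K₂ / Λ ^ 2))) := by
          have := mul_le_mul ha₁ hbr hbr0 (by positivity)
          linarith
      _ = (4 * c / Λ) * (t ^ 3 / Λ ^ 3) * (3 * ab₁ * (C₂ * (Real.sqrt 2 * K₁ + 10 * K₂) ^ 2 / 4 + C₁ * K₂ * Λ / 2)) := by field_simp; ring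
      _ ≤ (4 * c / Λ) * (t ^ 3 / Λ ^ 3) * (3 * ab₁ * (C₂ * (Real.sqrt 2 * K₁ + 10 * K₂) ^ 2 / 4 + C₁ * K₂ * e₀ / 2)) := by gcongr
  -- term E
  have TE : 3 * (a₂ * (C₁ * c / Λ ^ 2 * (K₁ * (Real.sqrt 2 * t) + 4 * (K₂ * (Real.sqrt 2 * t) ^ 2)))) ≤
      (4 * c / Λ) * (t ^ 3 / Λ ^ 3) * (3 / 4 * ab₂ * C₁ * (Real.sqrt 2 * K₁ + 8 * K₂)) := by
    have e4 : (2 : ℝ) * 4 = 8 := by norm_num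
    rw [e4] at h4
    have hbr0 : 0 ≤ C₁ * c / Λ ^ 2 * (K₁ * (Real.sqrt 2 * t) + 4 * (K₂ * (Real.sqrt 2 * t) ^ 2)) := by positivity
    have hbr : C₁ * c / Λ ^ 2 * (K₁ * (Real.sqrt 2 * t) + 4 * (K₂ * (Real.sqrt 2 * t) ^ 2)) ≤ C₁ * c / Λ ^ 2 * (t * (Real.sqrt 2 * K₁ + 8 * K₂)) :=
      mul_le_mul_of_nonneg_left h4 (by positivity)
    calc 3 * (a₂ * (C₁ * c / Λ ^ 2 * (K₁ * (Real.sqrt 2 * t) + 4 * (K₂ * (Real.sqrt 2 * t) ^ 2))))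
        ≤ 3 * ((t ^ 2 * ab₂ / Λ ^ 2) * (C₁ * c / Λ ^ 2 * (t * (Real.sqrt 2 * K₁ + 8 * K₂)))) := by
          have := mul_le_mul ha₂ hbr hbr0 (by positivity)
          linarith
      _ = (4 * c / Λ) * (t ^ 3 / Λ ^ 3) * (3 / 4 * ab₂ * C₁ * (Real.sqrt 2 * K₁ + 8 * K₂)) := by field_simp
  -- term F
  have TF : a₃ * (4 * c / Λ) ≤ (4 * c / Λ) * (t ^ 3 / Λ ^ 3) * ab₃ := by
    calc a₃ * (4 * c / Λ) ≤ (t ^ 3 * ab₃ / Λ ^ 3) * (4 * c / Λ) := mul_le_mul_of_nonneg_right ha₃ (by positivity)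
      _ = (4 * c / Λ) * (t ^ 3 / Λ ^ 3) * ab₃ := by field_simp
  have e : c₀ * (4 * c / Λ) * (t ^ 3 * (C₃ * (Real.sqrt 2 * K₁ + 12 * K₂) ^ 3 / 4 + 3 / 2 * C₂ * K₂ * (Real.sqrt 2 * K₁ + 12 * K₂) * e₀ +
        Real.sqrt 2 / 2 * C₁ * k₃ + 3 * ab₁ * (C₂ * (Real.sqrt 2 * K₁ + 10 * K₂) ^ 2 / 4 + C₁ * K₂ * e₀ / 2) +
        3 / 4 * ab₂ * C₁ * (Real.sqrt 2 * K₁ + 8 * K₂) + ab₃) / Λ ^ 3) =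
      c₀ * ((4 * c / Λ) * (t ^ 3 / Λ ^ 3) * (C₃ * (Real.sqrt 2 * K₁ + 12 * K₂) ^ 3 / 4) +
        (4 * c / Λ) * (t ^ 3 / Λ ^ 3) * (3 / 2 * C₂ * K₂ * (Real.sqrt 2 * K₁ + 12 * K₂) * e₀) +
        (4 * c / Λ) * (t ^ 3 / Λ ^ 3) * (Real.sqrt 2 / 2 * C₁ * k₃) +
        (4 * c / Λ) * (t ^ 3 / Λ ^ 3) * (3 * ab₁ * (C₂ * (Real.sqrt 2 * K₁ + 10 * K₂) ^ 2 / 4 + C₁ * K₂ * e₀ / 2)) +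
        (4 * c / Λ) * (t ^ 3 / Λ ^ 3) * (3 / 4 * ab₂ * C₁ * (Real.sqrt 2 * K₁ + 8 * K₂)) +
        (4 * c / Λ) * (t ^ 3 / Λ ^ 3) * ab₃) := by ring
  rw [e]
  refine mul_le_mul_of_nonneg_left ?_ hc₀
  linarith [TA, TB, TC, TD, TE, TF]

/-! ### §3 The tangent direction at the ISOTROPIC rate (order three): tangency slot `τ_t ≤ t·b_τ` -/

set_option maxHeartbeats 800000 in
/-- **The order-three Leibniz quantity of the tangent direction at the isotropic rate**: as `spaceLeibniz3_le` with the tangency slot `τ_t`,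
`0 ≤ τ_t ≤ t·b_τ`, `0 ≤ b_τ`: `Q₃ ≤ A₀·t³·q₃ᵛ/Λ³` with `q₃ᵛ = q₃[√2K₁ ↦ b_τ]`. [folklore] -/
theorem tangentLeibniz3_le_of_datum {c₀ c C₁ C₂ C₃ K₂ K₃ Λ e₀ t τt bτ a₁ a₂ a₃ ab₁ ab₂ ab₃ : ℝ} (hc₀ : 0 ≤ c₀) (hc : 0 ≤ c) (hC₁ : 0 ≤ C₁)
    (hC₂ : 0 ≤ C₂) (hC₃ : 0 ≤ C₃) (hK₂ : 0 ≤ K₂) {k₃ : ℝ} (hk₃ : K₃ * Λ ^ 2 ≤ k₃) (hΛ : 0 < Λ) (hΛe : Λ ≤ e₀) (ht0 : 0 ≤ t) (ht1 : t ≤ 1)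
    (hτt0 : 0 ≤ τt) (hbτ : 0 ≤ bτ) (hτt : τt ≤ t * bτ)
    (hab₁ : 0 ≤ ab₁) (hab₂ : 0 ≤ ab₂) (ha₁ : a₁ ≤ t * ab₁ / Λ) (ha₂ : a₂ ≤ t ^ 2 * ab₂ / Λ ^ 2) (ha₃ : a₃ ≤ t ^ 3 * ab₃ / Λ ^ 3) :
    c₀ * (1 * (C₃ * c / Λ ^ 4 * (τt + 6 * (K₂ * (Real.sqrt 2 * t) ^ 2)) ^ 3 +
          3 * (C₂ * c / Λ ^ 3 * (τt + 6 * (K₂ * (Real.sqrt 2 * t) ^ 2)) * (K₂ * (Real.sqrt 2 * t) ^ 2)) +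
          C₁ * c / Λ ^ 2 * (K₃ * (Real.sqrt 2 * t) ^ 3)) +
        3 * (a₁ * (C₂ * c / Λ ^ 3 * (τt + 5 * (K₂ * (Real.sqrt 2 * t) ^ 2)) ^ 2 + C₁ * c / Λ ^ 2 * (K₂ * (Real.sqrt 2 * t) ^ 2))) +
        3 * (a₂ * (C₁ * c / Λ ^ 2 * (τt + 4 * (K₂ * (Real.sqrt 2 * t) ^ 2)))) + a₃ * (4 * c / Λ)) ≤
      c₀ * (4 * c / Λ) * (t ^ 3 * (C₃ * (bτ + 12 * K₂) ^ 3 / 4 + 3 / 2 * C₂ * K₂ * (bτ + 12 * K₂) * e₀ +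
        Real.sqrt 2 / 2 * C₁ * k₃ + 3 * ab₁ * (C₂ * (bτ + 10 * K₂) ^ 2 / 4 + C₁ * K₂ * e₀ / 2) +
        3 / 4 * ab₂ * C₁ * (bτ + 8 * K₂) + ab₃) / Λ ^ 3) := by
  have hs2 : Real.sqrt 2 ^ 2 = 2 := Real.sq_sqrt (by norm_num)
  have hs3 : Real.sqrt 2 ^ 3 = 2 * Real.sqrt 2 := by rw [pow_succ, hs2]
  have hs0 : 0 ≤ Real.sqrt 2 := Real.sqrt_nonneg 2
  have he₀ : 0 < e₀ := lt_of_lt_of_le hΛ hΛe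
  have ht2 : t ^ 2 ≤ t := by nlinarith
  have hst : (Real.sqrt 2 * t) ^ 2 = 2 * t ^ 2 := by rw [mul_pow, hs2]
  have hst3 : (Real.sqrt 2 * t) ^ 3 = 2 * Real.sqrt 2 * t ^ 3 := by rw [mul_pow, hs3]
  have hX : ∀ k : ℝ, 0 ≤ k → τt + k * (K₂ * (Real.sqrt 2 * t) ^ 2) ≤ t * (bτ + 2 * k * K₂) := by
    intro k hk
    rw [hst]
    have e : t * (bτ + 2 * k * K₂) = t * bτ + 2 * k * (K₂ * t) := by ring
    rw [e]
    have := mul_le_mul_of_nonneg_left ht2 (by positivity : 0 ≤ 2 * k * K₂)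
    nlinarith [this]
  have hX0 : ∀ k : ℝ, 0 ≤ k → 0 ≤ τt + k * (K₂ * (Real.sqrt 2 * t) ^ 2) := fun k hk => by positivity
  have h6 := hX 6 (by norm_num); have h60 := hX0 6 (by norm_num)
  have h5 := hX 5 (by norm_num); have h50 := hX0 5 (by norm_num)
  have h4 := hX 4 (by norm_num); have h40 := hX0 4 (by norm_num)
  have hY : K₂ * (Real.sqrt 2 * t) ^ 2 = 2 * K₂ * t ^ 2 := by rw [hst]; ring
  have hΛ2 := pow_pos hΛ 2; have hΛ3 := pow_pos hΛ 3; have hΛ4 := pow_pos hΛ 4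
  have TA : C₃ * c / Λ ^ 4 * (τt + 6 * (K₂ * (Real.sqrt 2 * t) ^ 2)) ^ 3 ≤ (4 * c / Λ) * (t ^ 3 / Λ ^ 3) * (C₃ * (bτ + 12 * K₂) ^ 3 / 4) := by
    have h := pow_le_pow_left₀ h60 h6 3
    have e6 : (2 : ℝ) * 6 = 12 := by norm_num
    rw [e6] at h
    calc C₃ * c / Λ ^ 4 * (τt + 6 * (K₂ * (Real.sqrt 2 * t) ^ 2)) ^ 3
        ≤ C₃ * c / Λ ^ 4 * (t * (bτ + 12 * K₂)) ^ 3 := mul_le_mul_of_nonneg_left h (by positivity)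
      _ = (4 * c / Λ) * (t ^ 3 / Λ ^ 3) * (C₃ * (bτ + 12 * K₂) ^ 3 / 4) := by field_simp
  have TB : 3 * (C₂ * c / Λ ^ 3 * (τt + 6 * (K₂ * (Real.sqrt 2 * t) ^ 2)) * (K₂ * (Real.sqrt 2 * t) ^ 2)) ≤
      (4 * c / Λ) * (t ^ 3 / Λ ^ 3) * (3 / 2 * C₂ * K₂ * (bτ + 12 * K₂) * e₀) := by
    have e6 : (2 : ℝ) * 6 = 12 := by norm_num
    rw [e6] at h6
    calc 3 * (C₂ * c / Λ ^ 3 * (τt + 6 * (K₂ * (Real.sqrt 2 * t) ^ 2)) * (K₂ * (Real.sqrt 2 * t) ^ 2))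
        ≤ 3 * (C₂ * c / Λ ^ 3 * (t * (bτ + 12 * K₂)) * (K₂ * (Real.sqrt 2 * t) ^ 2)) := by
          have := mul_le_mul_of_nonneg_left h6 (by positivity : 0 ≤ C₂ * c / Λ ^ 3)
          have := mul_le_mul_of_nonneg_right this (by positivity : 0 ≤ K₂ * (Real.sqrt 2 * t) ^ 2)
          linarith
      _ = (4 * c / Λ) * (t ^ 3 / Λ ^ 3) * (3 / 2 * C₂ * K₂ * (bτ + 12 * K₂) * Λ) := by rw [hY]; field_simp; ring
      _ ≤ (4 * c / Λ) * (t ^ 3 / Λ ^ 3) * (3 / 2 * C₂ * K₂ * (bτ + 12 * K₂) * e₀) := by gcongr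
  have TC : C₁ * c / Λ ^ 2 * (K₃ * (Real.sqrt 2 * t) ^ 3) ≤ (4 * c / Λ) * (t ^ 3 / Λ ^ 3) * (Real.sqrt 2 / 2 * C₁ * k₃) := by
    rw [hst3]
    calc C₁ * c / Λ ^ 2 * (K₃ * (2 * Real.sqrt 2 * t ^ 3)) = (4 * c / Λ) * (t ^ 3 / Λ ^ 3) * (Real.sqrt 2 / 2 * C₁ * (K₃ * Λ ^ 2)) := by
          field_simp; ring
      _ ≤ (4 * c / Λ) * (t ^ 3 / Λ ^ 3) * (Real.sqrt 2 / 2 * C₁ * k₃) := by gcongr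
  have TD : 3 * (a₁ * (C₂ * c / Λ ^ 3 * (τt + 5 * (K₂ * (Real.sqrt 2 * t) ^ 2)) ^ 2 + C₁ * c / Λ ^ 2 * (K₂ * (Real.sqrt 2 * t) ^ 2))) ≤
      (4 * c / Λ) * (t ^ 3 / Λ ^ 3) * (3 * ab₁ * (C₂ * (bτ + 10 * K₂) ^ 2 / 4 + C₁ * K₂ * e₀ / 2)) := by
    have e5 : (2 : ℝ) * 5 = 10 := by norm_num
    rw [e5] at h5
    have hbr0 : 0 ≤ C₂ * c / Λ ^ 3 * (τt + 5 * (K₂ * (Real.sqrt 2 * t) ^ 2)) ^ 2 + C₁ * c / Λ ^ 2 * (K₂ * (Real.sqrt 2 * t) ^ 2) := by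
      positivity
    have hbr : C₂ * c / Λ ^ 3 * (τt + 5 * (K₂ * (Real.sqrt 2 * t) ^ 2)) ^ 2 + C₁ * c / Λ ^ 2 * (K₂ * (Real.sqrt 2 * t) ^ 2) ≤
        t ^ 2 * (C₂ * c * (bτ + 10 * K₂) ^ 2 / Λ ^ 3 + 2 * C₁ * c * K₂ / Λ ^ 2) := by
      have hsq := pow_le_pow_left₀ h50 h5 2
      have t1 := mul_le_mul_of_nonneg_left hsq (by positivity : 0 ≤ C₂ * c / Λ ^ 3)
      have e : t ^ 2 * (C₂ * c * (bτ + 10 * K₂) ^ 2 / Λ ^ 3 + 2 * C₁ * c * K₂ / Λ ^ 2) =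
          C₂ * c / Λ ^ 3 * (t * (bτ + 10 * K₂)) ^ 2 + C₁ * c / Λ ^ 2 * (K₂ * (Real.sqrt 2 * t) ^ 2) := by rw [hY]; ring
      rw [e]; linarith
    calc 3 * (a₁ * (C₂ * c / Λ ^ 3 * (τt + 5 * (K₂ * (Real.sqrt 2 * t) ^ 2)) ^ 2 + C₁ * c / Λ ^ 2 * (K₂ * (Real.sqrt 2 * t) ^ 2)))
        ≤ 3 * ((t * ab₁ / Λ) * (t ^ 2 * (C₂ * c * (bτ + 10 * K₂) ^ 2 / Λ ^ 3 + 2 * C₁ * c * K₂ / Λ ^ 2))) := by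
          have := mul_le_mul ha₁ hbr hbr0 (by positivity)
          linarith
      _ = (4 * c / Λ) * (t ^ 3 / Λ ^ 3) * (3 * ab₁ * (C₂ * (bτ + 10 * K₂) ^ 2 / 4 + C₁ * K₂ * Λ / 2)) := by field_simp; ring
      _ ≤ (4 * c / Λ) * (t ^ 3 / Λ ^ 3) * (3 * ab₁ * (C₂ * (bτ + 10 * K₂) ^ 2 / 4 + C₁ * K₂ * e₀ / 2)) := by gcongr
  have TE : 3 * (a₂ * (C₁ * c / Λ ^ 2 * (τt + 4 * (K₂ * (Real.sqrt 2 * t) ^ 2)))) ≤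
      (4 * c / Λ) * (t ^ 3 / Λ ^ 3) * (3 / 4 * ab₂ * C₁ * (bτ + 8 * K₂)) := by
    have e4 : (2 : ℝ) * 4 = 8 := by norm_num
    rw [e4] at h4
    have hbr0 : 0 ≤ C₁ * c / Λ ^ 2 * (τt + 4 * (K₂ * (Real.sqrt 2 * t) ^ 2)) := by positivity
    have hbr : C₁ * c / Λ ^ 2 * (τt + 4 * (K₂ * (Real.sqrt 2 * t) ^ 2)) ≤ C₁ * c / Λ ^ 2 * (t * (bτ + 8 * K₂)) :=
      mul_le_mul_of_nonneg_left h4 (by positivity)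
    calc 3 * (a₂ * (C₁ * c / Λ ^ 2 * (τt + 4 * (K₂ * (Real.sqrt 2 * t) ^ 2))))
        ≤ 3 * ((t ^ 2 * ab₂ / Λ ^ 2) * (C₁ * c / Λ ^ 2 * (t * (bτ + 8 * K₂)))) := by
          have := mul_le_mul ha₂ hbr hbr0 (by positivity)
          linarith
      _ = (4 * c / Λ) * (t ^ 3 / Λ ^ 3) * (3 / 4 * ab₂ * C₁ * (bτ + 8 * K₂)) := by field_simp
  have TF : a₃ * (4 * c / Λ) ≤ (4 * c / Λ) * (t ^ 3 / Λ ^ 3) * ab₃ := by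
    calc a₃ * (4 * c / Λ) ≤ (t ^ 3 * ab₃ / Λ ^ 3) * (4 * c / Λ) := mul_le_mul_of_nonneg_right ha₃ (by positivity)
      _ = (4 * c / Λ) * (t ^ 3 / Λ ^ 3) * ab₃ := by field_simp
  have e : c₀ * (4 * c / Λ) * (t ^ 3 * (C₃ * (bτ + 12 * K₂) ^ 3 / 4 + 3 / 2 * C₂ * K₂ * (bτ + 12 * K₂) * e₀ +
        Real.sqrt 2 / 2 * C₁ * k₃ + 3 * ab₁ * (C₂ * (bτ + 10 * K₂) ^ 2 / 4 + C₁ * K₂ * e₀ / 2) +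
        3 / 4 * ab₂ * C₁ * (bτ + 8 * K₂) + ab₃) / Λ ^ 3) =
      c₀ * ((4 * c / Λ) * (t ^ 3 / Λ ^ 3) * (C₃ * (bτ + 12 * K₂) ^ 3 / 4) +
        (4 * c / Λ) * (t ^ 3 / Λ ^ 3) * (3 / 2 * C₂ * K₂ * (bτ + 12 * K₂) * e₀) +
        (4 * c / Λ) * (t ^ 3 / Λ ^ 3) * (Real.sqrt 2 / 2 * C₁ * k₃) +
        (4 * c / Λ) * (t ^ 3 / Λ ^ 3) * (3 * ab₁ * (C₂ * (bτ + 10 * K₂) ^ 2 / 4 + C₁ * K₂ * e₀ / 2)) +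
        (4 * c / Λ) * (t ^ 3 / Λ ^ 3) * (3 / 4 * ab₂ * C₁ * (bτ + 8 * K₂)) +
        (4 * c / Λ) * (t ^ 3 / Λ ^ 3) * ab₃) := by ring
  rw [e]
  refine mul_le_mul_of_nonneg_left ?_ hc₀
  linarith [TA, TB, TC, TD, TE, TF]

end Summit.HubbardSuperconductivity.HubbardSuperconductivity.Theorems.TorusFourierL2

end
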